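import Summits.CriticalPhenomena.PercolationContinuityZ3.Theorems.PercNearOneGluingNoHeavyQuantJointBlobHull
import HarnessLib

/-!
# QUANT lane R8, T-DEC: THE SHIFT OBSTRUCTION TO THE BLOB HULL (kernel anchor of typer g40's refutation of JR₃) — the law
# `A ∗ δ₆` (A = glued `R²[9/10](R 3/5)`, the limit of `A` beside two near-deterministic proper siblings) is NOT in the blob hull `K_x(417/50)`
# at any floor `x > 17/50`, and IS in it at every floor `x ≤ 17/50`

builds on p205010 (kernel theorem, internal audit signed; external expert review pending)

Support file (`--supports stmt-CriticalPhenomena-4575`), QUANT lane typer seat prim-quant-stmt (gen 40), rung R8 of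
`run/shared/lean/prim/quant/LADDER.md`; memo `run/shared/lean/prim/quant/prim-quant-stmt-g40/JR3-NEARSURE-G40.md` §3.  Three small definitions
(`sureTop`, `nsTop`, `nsMean`: the sure / non-sure bookkeeping of a blob list), theorems with standard axioms, no sorries.

THE OBSTRUCTION.  `limitLaw = (6 ↦ 1/10, 8 ↦ 9/25, 9 ↦ 27/50)` is the count law of the sibling `A = gate_{9/10}(δ₂ ∗ relay 3/5)` (law
`(1/10, 0, 9/25, 27/50)`, leaf marginal `27/50`) shifted by a sure blob of size `6` — the `ε → 0` limit of the forest laws of `[A, T_ε, T_ε]` for ANY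
proper siblings `T_ε → δ₃` (near-deterministic partners: `glued(1−ε,1−ε)`, 3-chains `(1−ε)³`, …), all of which lie in the binders of
`LawDec.JointBlobHull` / `JointBlobHull₃` (✓ `…QuantJointBlobHull`) at floor `1/2`.  **`limitLaw_not_inBlobHull`**: for every floor `x > 17/50` the law is
NOT a mixture of independent-heavy-blob laws with gates in `[x,1]`, tops `≤ 9`, mean `417/50`: a component with positive weight lives on `{6,8,9}`; its
sure blobs total `c` with `blobLaw l c > 0` (`blobLaw_sureTop_pos`), so `c ∈ {6,8,9}`; `c = 9` forces mean `9`; `c = 8` leaves non-sure size `≤ 1` and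
non-sure mean `17/50`, i.e. one relay of gate `17/50 < x`; `c = 6` forbids non-sure sizes `1` (mass at `7`) and `2` (mean `≤ 2 < 117/50`), and sizes in
`{0} ∪ [3, ∞)` put no mass at `c + 2 = 8` (`blobLaw_sureTop_add_two`) — so EVERY component vanishes at `8`, contradicting `9/25`.  Since the hull graph
`{(m, μ) : μ ∈ K_x(m)}` is compact, the forest laws of `[A, T_ε, T_ε]` leave the hull for small `ε` (exact LP: OUT at `ε = 1/100`): `JointBlobHull` and
`JointBlobHull₃` are false at the law level (memo §3; the compactness step is not formalised here).  **`limitLaw_inBlobHull_of_le`**: at floors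
`x ≤ 17/50` the same law IS in the hull — `5/11·(δ₆ ∗ blob₃(39/50)) + 6/11·(δ₈ ∗ relay(17/50))` — so the obstruction is floor-sensitive.  The NODE
(`SiblingStep`) holds on the same family (memo §5, exact DEC LP): the blob hull is a FAMILY (`sdec_of_inBlobHull`, `sdec_siblings_of_reducible`), not a node.

* `sureTop`, `nsTop`, `nsMean`; `blobTop_eq`, `blobMean_eq`, `nsMean_le_nsTop`, `mul_nsTop_le_nsMean`;
* `slice support lemmas`: `blobLaw_lt_sureTop` (no mass below the sure total), `blobLaw_sureTop_pos` (the all-fail atom), `blobLaw_sureTop_add_pos`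
  (a non-sure blob of size `a` charges `sureTop + a`), `blobLaw_sureTop_add_two` / `_add_one` (sizes in `{0} ∪ [3,∞)` do not charge `sureTop + 1, + 2`);
* **`blobLaw_eight_eq_zero`** (the key lemma), **`limitLaw_not_inBlobHull`**, **`limitLaw_inBlobHull_of_le`**.

[this work].  Nothing here is cited as a published result.  The gluing rows served [cite: KozmaNitzan2024, Conjecture 3 (p. 15)]; product measure
[cite: Grimmett1999, §1.3 p. 10].
-/

noncomputable section

open scoped BigOperators

namespace Summit.CriticalPhenomena.PercolationContinuityZ3.Theorems
namespace Quant
namespace LawDec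

open Finset

/-! ### Sure / non-sure bookkeeping of a blob list -/

/-- total size of the SURE blobs (gate `= 1`) of a blob list. [this work] -/
def sureTop : List (ℕ × ℝ) → ℕ
  | [] => 0
  | p :: l => sureTop l + (if p.2 = 1 then p.1 else 0)

/-- total size of the NON-sure blobs (gate `≠ 1`). [this work] -/
def nsTop : List (ℕ × ℝ) → ℕ
  | [] => 0
  | p :: l => nsTop l + (if p.2 = 1 then 0 else p.1)

/-- mean carried by the non-sure blobs: `Σ_{g ≠ 1} a·g`. [this work] -/
def nsMean : List (ℕ × ℝ) → ℝ
  | [] => 0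
  | p :: l => nsMean l + (if p.2 = 1 then 0 else (p.1 : ℝ) * p.2)

/-- `blobTop = sureTop + nsTop`. [this work] -/
theorem blobTop_eq (l : List (ℕ × ℝ)) : blobTop l = sureTop l + nsTop l := by
  induction l with
  | nil => rfl
  | cons p l ih => simp only [blobTop, sureTop, nsTop, ih]; split_ifs <;> omega

/-- `blobMean = sureTop + nsMean`. [this work] -/
theorem blobMean_eq (l : List (ℕ × ℝ)) : blobMean l = (sureTop l : ℝ) + nsMean l := by
  induction l with
  | nil => simp [blobMean, sureTop, nsMean]
  | cons p l ih =>
    simp only [blobMean, sureTop, nsMean, ih]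
    split_ifs with h
    · rw [h]; push_cast; ring
    · push_cast; ring

/-- `nsMean ≤ nsTop` when all gates are `≤ 1`. [this work] -/
theorem nsMean_le_nsTop (l : List (ℕ × ℝ)) (hl : ∀ p ∈ l, p.2 ≤ 1) : nsMean l ≤ (nsTop l : ℝ) := by
  induction l with
  | nil => simp [nsMean, nsTop]
  | cons p l ih =>
    have ih' := ih fun p' hp' => hl p' (List.mem_cons_of_mem p hp')
    have hp := hl p List.mem_cons_self
    simp only [nsMean, nsTop]
    split_ifs
    · push_cast; linarith
    · push_cast; nlinarith [(Nat.cast_nonneg p.1 : (0 : ℝ) ≤ p.1)]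

/-- `x·nsTop ≤ nsMean` when all gates are `≥ x`. [this work] -/
theorem mul_nsTop_le_nsMean (x : ℝ) (l : List (ℕ × ℝ)) (hl : ∀ p ∈ l, x ≤ p.2) : x * (nsTop l : ℝ) ≤ nsMean l := by
  induction l with
  | nil => simp [nsMean, nsTop]
  | cons p l ih =>
    have ih' := ih fun p' hp' => hl p' (List.mem_cons_of_mem p hp')
    have hp := hl p List.mem_cons_self
    simp only [nsMean, nsTop]
    split_ifs
    · push_cast; linarith
    · push_cast; nlinarith [(Nat.cast_nonneg p.1 : (0 : ℝ) ≤ p.1)]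

/-- `sureTop`, `nsTop`, `nsMean` of an appended list. [this work] -/
theorem sure_ns_append (l₁ l₂ : List (ℕ × ℝ)) :
    sureTop (l₁ ++ l₂) = sureTop l₂ + sureTop l₁ ∧ nsTop (l₁ ++ l₂) = nsTop l₂ + nsTop l₁ ∧ nsMean (l₁ ++ l₂) = nsMean l₂ + nsMean l₁ := by
  induction l₁ with
  | nil => simp [sureTop, nsTop, nsMean]
  | cons p l ih =>
    obtain ⟨h1, h2, h3⟩ := ih
    refine ⟨?_, ?_, ?_⟩
    · simp only [List.cons_append, sureTop, h1]; omega
    · simp only [List.cons_append, nsTop, h2]; omega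
    · simp only [List.cons_append, nsMean, h3]; ring

/-! ### Support of a blob law relative to the sure total -/

/-- **no mass below the sure total.** [this work] -/
theorem blobLaw_lt_sureTop (l : List (ℕ × ℝ)) : ∀ h, h < sureTop l → blobLaw l h = 0 := by
  induction l with
  | nil => intro h hh; simp [sureTop] at hh
  | cons p l ih =>
    intro h hh
    simp only [sureTop] at hh
    simp only [blobLaw, slice]
    split_ifs at hh with hs
    · -- sure blob: pure shift
      rw [hs]
      split_ifs with ha
      · rw [ih (h - p.1) (by omega)]; ring
      · ring
    · split_ifs with ha
      · rw [ih h (by omega), ih (h - p.1) (by omega)]; ring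
      · rw [ih h (by omega)]; ring

/-- **the all-fail atom**: a blob list with gates in `[0,1]` charges its sure total. [this work] -/
theorem blobLaw_sureTop_pos (l : List (ℕ × ℝ)) (hl : ∀ p ∈ l, 0 ≤ p.2 ∧ p.2 ≤ 1) : 0 < blobLaw l (sureTop l) := by
  induction l with
  | nil => simp [blobLaw, sureTop]
  | cons p l ih =>
    have hl' : ∀ p' ∈ l, 0 ≤ p'.2 ∧ p'.2 ≤ 1 := fun p' hp' => hl p' (List.mem_cons_of_mem p hp')
    have ih' := ih hl'
    obtain ⟨hp0, hp1⟩ := hl p List.mem_cons_self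
    simp only [blobLaw, slice, sureTop]
    split_ifs with hs ha
    · rw [hs, Nat.add_sub_cancel]; linarith
    · exact absurd (Nat.le_add_left p.1 (sureTop l)) ha
    · have hlt : p.2 < 1 := lt_of_le_of_ne hp1 hs
      have h2 : 0 ≤ blobLaw l (sureTop l + 0 - p.1) := blobLaw_nonneg l hl' _
      rw [Nat.add_zero] at h2 ⊢
      nlinarith [blobLaw_nonneg l hl' (sureTop l - p.1)]
    · have hlt : p.2 < 1 := lt_of_le_of_ne hp1 hs
      rw [Nat.add_zero]; nlinarith

/-- **a non-sure blob of size `a` charges `sureTop + a`** (that blob succeeds, every other non-sure blob fails). [this work] -/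
theorem blobLaw_sureTop_add_pos (l : List (ℕ × ℝ)) (hl : ∀ p ∈ l, 0 ≤ p.2 ∧ p.2 ≤ 1) (p₀ : ℕ × ℝ) (hp₀ : p₀ ∈ l) (hns : p₀.2 ≠ 1)
    (hg0 : 0 < p₀.2) : 0 < blobLaw l (sureTop l + p₀.1) := by
  induction l with
  | nil => simp at hp₀
  | cons p l ih =>
    have hl' : ∀ p' ∈ l, 0 ≤ p'.2 ∧ p'.2 ≤ 1 := fun p' hp' => hl p' (List.mem_cons_of_mem p hp')
    obtain ⟨hp0, hp1⟩ := hl p List.mem_cons_self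
    simp only [blobLaw, slice, sureTop]
    rcases List.mem_cons.1 hp₀ with rfl | hmem
    · -- the head is the distinguished non-sure blob
      rw [if_neg hns, Nat.add_zero, if_pos (Nat.le_add_left _ _), Nat.add_sub_cancel]
      have h1 := blobLaw_sureTop_pos l hl'
      have hlt : p₀.2 < 1 := lt_of_le_of_ne hp1 hns
      nlinarith [blobLaw_nonneg l hl' (sureTop l + p₀.1)]
    · have ih' := ih hl' hmem
      split_ifs with hs ha
      · rw [hs, show sureTop l + p.1 + p₀.1 - p.1 = sureTop l + p₀.1 by omega]; linarith
      · exfalso; apply ha; omega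
      · have hlt : p.2 < 1 := lt_of_le_of_ne hp1 hs
        rw [Nat.add_zero]
        nlinarith [blobLaw_nonneg l hl' (sureTop l + p₀.1 - p.1)]
      · have hlt : p.2 < 1 := lt_of_le_of_ne hp1 hs
        rw [Nat.add_zero]; nlinarith

/-- **blob lists whose non-sure sizes avoid `1` and `2` put no mass at `sureTop + 1` and `sureTop + 2`.** [this work] -/
theorem blobLaw_sureTop_add_le_two (l : List (ℕ × ℝ)) (hl : ∀ p ∈ l, p.2 ≠ 1 → p.1 = 0 ∨ 3 ≤ p.1) :
    blobLaw l (sureTop l + 1) = 0 ∧ blobLaw l (sureTop l + 2) = 0 := by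
  induction l with
  | nil => simp [blobLaw, sureTop]
  | cons p l ih =>
    have hl' : ∀ p' ∈ l, p'.2 ≠ 1 → p'.1 = 0 ∨ 3 ≤ p'.1 := fun p' hp' => hl p' (List.mem_cons_of_mem p hp')
    obtain ⟨ih1, ih2⟩ := ih hl'
    have hz := blobLaw_lt_sureTop l
    simp only [blobLaw, slice, sureTop]
    by_cases hs : p.2 = 1
    · rw [if_pos hs, hs]
      refine ⟨?_, ?_⟩
      · rw [if_pos (by omega), show sureTop l + p.1 + 1 - p.1 = sureTop l + 1 by omega, ih1]; ring
      · rw [if_pos (by omega), show sureTop l + p.1 + 2 - p.1 = sureTop l + 2 by omega, ih2]; ring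
    · rw [if_neg hs, Nat.add_zero]
      rcases hl p List.mem_cons_self hs with h0 | h3
      · rw [h0]
        simp only [Nat.zero_le, if_true, Nat.sub_zero]
        rw [ih1, ih2]; constructor <;> ring
      · refine ⟨?_, ?_⟩
        · rw [ih1]
          split_ifs with ha
          · rw [hz _ (by omega)]; ring
          · ring
        · rw [ih2]
          split_ifs with ha
          · rw [hz _ (by omega)]; ring
          · ring

/-! ### The key lemma and the obstruction -/

/-- **KEY LEMMA**: a blob list with gates in `[x, 1]`, `x > 17/50`, top `≤ 9`, mean `417/50`, whose law lives on `{6, 8, 9}`, puts NO mass at `8`.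
[this work] -/
theorem blobLaw_eight_eq_zero {x : ℝ} (hx : (17 : ℝ) / 50 < x) (l : List (ℕ × ℝ)) (hl : ∀ p ∈ l, x ≤ p.2 ∧ p.2 ≤ 1)
    (htop : blobTop l ≤ 9) (hmean : blobMean l = 417 / 50)
    (hz : ∀ h, h ≠ 6 → h ≠ 8 → h ≠ 9 → blobLaw l h = 0) : blobLaw l 8 = 0 := by
  have hx0 : 0 < x := by linarith
  have hl0 : ∀ p ∈ l, 0 ≤ p.2 ∧ p.2 ≤ 1 := fun p hp => ⟨hx0.le.trans (hl p hp).1, (hl p hp).2⟩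
  have hpos := blobLaw_sureTop_pos l hl0
  have htopeq := blobTop_eq l
  have hmeaneq := blobMean_eq l
  have hle := nsMean_le_nsTop l fun p hp => (hl p hp).2
  have hge := mul_nsTop_le_nsMean x l fun p hp => (hl p hp).1
  -- the sure total is an atom of the law, hence `6`, `8` or `9`
  have hc : sureTop l = 6 ∨ sureTop l = 8 ∨ sureTop l = 9 := by
    by_contra hc
    push Not at hc
    have := hz (sureTop l) hc.1 hc.2.1 hc.2.2
    linarith
  rcases hc with hc | hc | hc
  · -- c = 6: no non-sure blob of size 1 (it would charge 7) or 2 (mean), the rest cannot charge 8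
    have hsizes : ∀ p ∈ l, p.2 ≠ 1 → p.1 = 0 ∨ 3 ≤ p.1 := by
      intro p hp hns
      have hgp : 0 < p.2 := hx0.trans_le (hl p hp).1
      by_contra hbad
      push Not at hbad
      obtain ⟨h0, h3⟩ := hbad
      have h12 : p.1 = 1 ∨ p.1 = 2 := by omega
      rcases h12 with h1 | h2
      · have := blobLaw_sureTop_add_pos l hl0 p hp hns hgp
        rw [hc, h1] at this
        have h7 := hz 7 (by norm_num) (by norm_num) (by norm_num)
        linarith
      · -- size 2: split the list at `p`; every OTHER non-sure blob has size 0 (size 1 would charge 7, sizes sum ≤ 1)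
        obtain ⟨S, T, rfl⟩ := List.append_of_mem hp
        obtain ⟨e1, e2, e3⟩ := sure_ns_append S (p :: T)
        simp only [sureTop, nsTop, nsMean, if_neg hns] at e1 e2 e3
        have hother : ∀ p' ∈ S ++ T, p'.2 ≠ 1 → p'.1 = 0 := by
          intro p' hp' hns'
          have hp'l : p' ∈ S ++ p :: T := by
            rw [List.mem_append] at hp' ⊢
            rcases hp' with h | h
            · exact Or.inl h
            · exact Or.inr (List.mem_cons_of_mem p h)
          have hgp' : 0 < p'.2 := hx0.trans_le (hl p' hp'l).1
          by_contra hne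
          -- `p'` has positive size; sizes: nsTop = 2 + nsTop S + nsTop T ≤ 3, so `p'.1 = 1`, charging `7`
          obtain ⟨S', T', hdecomp⟩ := List.append_of_mem hp'
          have hsz : p'.1 = 1 := by
            obtain ⟨_, f2, _⟩ := sure_ns_append S' (p' :: T')
            simp only [nsTop, if_neg hns'] at f2
            obtain ⟨_, g2, _⟩ := sure_ns_append S T
            have : nsTop (S ++ T) = nsTop T + nsTop S := g2
            rw [hdecomp] at this
            omega
          have := blobLaw_sureTop_add_pos (S ++ p :: T) hl0 p' hp'l hns' hgp'
          rw [hc, hsz] at this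
          have h7 := hz 7 (by norm_num) (by norm_num) (by norm_num)
          linarith
        -- hence the non-sure mean of the others vanishes and the total non-sure mean is `2·g ≤ 2 < 117/50`
        have hns0 : ∀ L : List (ℕ × ℝ), (∀ p' ∈ L, p'.2 ≠ 1 → p'.1 = 0) → nsMean L = 0 := by
          intro L hL
          induction L with
          | nil => rfl
          | cons p' L ih =>
            simp only [nsMean]
            rw [ih fun p'' hp'' => hL p'' (List.mem_cons_of_mem p' hp'')]
            split_ifs with hs'
            · ring
            · rw [hL p' List.mem_cons_self hs']; push_cast; ring
        have hS0 : nsMean S = 0 := hns0 S fun p' hp' => hother p' (List.mem_append_left T hp')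
        have hT0 : nsMean T = 0 := hns0 T fun p' hp' => hother p' (List.mem_append_right S hp')
        have hg1 : p.2 ≤ 1 := (hl p hp).2
        rw [hmeaneq, hc, e3, hS0, hT0, h2] at hmean
        push_cast at hmean
        nlinarith
    have := (blobLaw_sureTop_add_le_two l hsizes).2
    rwa [hc] at this
  · -- c = 8: the non-sure blobs have total size ≤ 1 and mean 17/50 — a relay of gate 17/50 < x
    exfalso
    rw [hc] at htopeq hmeaneq
    have hns1 : nsTop l ≤ 1 := by omega
    rw [hmeaneq] at hmean
    push_cast at hmean
    interval_cases h : nsTop l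
    · simp at hge hle; linarith
    · simp at hge; linarith
  · -- c = 9: the law is `δ₉`, mean `9`
    exfalso
    have hz9 : ∀ h, h < 9 → blobLaw l h = 0 := fun h hh => blobLaw_lt_sureTop l h (by omega)
    have hsum := sum_blobLaw_of_le l htop
    have hmn := sum_mul_blobLaw_of_le l htop
    rw [Finset.sum_range_succ] at hsum hmn
    rw [Finset.sum_eq_zero (fun h hh => hz9 h (Finset.mem_range.1 hh))] at hsum
    rw [Finset.sum_eq_zero (fun h hh => by rw [hz9 h (Finset.mem_range.1 hh), mul_zero])] at hmn
    rw [hmean] at hmn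
    push_cast at hsum hmn
    linarith

/-- the limit law `A ∗ δ₆`: `6 ↦ 1/10`, `8 ↦ 9/25`, `9 ↦ 27/50`. [this work] -/
def limitLaw : ℕ → ℝ := fun h => if h = 6 then 1 / 10 else if h = 8 then 9 / 25 else if h = 9 then 27 / 50 else 0

/-- **THE SHIFT OBSTRUCTION**: for every floor `x > 17/50`, `limitLaw ∉ K_x(417/50)` (top `9`). [this work] -/
theorem limitLaw_not_inBlobHull {x : ℝ} (hx : (17 : ℝ) / 50 < x) : ¬ InBlobHull x (417 / 50) 9 limitLaw := by
  rintro ⟨ι, hι, w, l, hw0, hw1, hg, htop, hmean, hmix⟩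
  have hx0 : 0 < x := by linarith
  -- every component vanishes at `8`
  have h8 : ∀ i, w i * blobLaw (l i) 8 = 0 := by
    intro i
    rcases eq_or_lt_of_le (hw0 i) with hwi | hwi
    · rw [← hwi, zero_mul]
    · rw [blobLaw_eight_eq_zero hx (l i) (hg i) (htop i) (hmean i) fun h h6 h8 h9 => ?_, mul_zero]
      -- a positively weighted component vanishes wherever the mixture does
      have hL : limitLaw h = 0 := by simp only [limitLaw, if_neg h6, if_neg h8, if_neg h9]
      have hsum : ∑ j, w j * blobLaw (l j) h = 0 := by rw [← hmix h, hL]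
      have hnn : ∀ j ∈ (Finset.univ : Finset ι), 0 ≤ w j * blobLaw (l j) h := fun j _ =>
        mul_nonneg (hw0 j) (blobLaw_nonneg (l j) (fun p hp => ⟨hx0.le.trans (hg j p hp).1, (hg j p hp).2⟩) h)
      have := (Finset.sum_eq_zero_iff_of_nonneg hnn).1 hsum i (Finset.mem_univ i)
      rcases mul_eq_zero.1 this with h0 | h0
      · exact absurd h0 hwi.ne'
      · exact h0
  have := hmix 8
  rw [Finset.sum_eq_zero (fun i _ => h8 i)] at this
  norm_num [limitLaw] at this

/-- **… and at floors `x ≤ 17/50` the same law IS in the hull**: `5/11·(δ₆ ∗ blob₃(39/50)) + 6/11·(δ₈ ∗ relay(17/50))` (floor-sensitivity of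
the obstruction). [this work] -/
theorem limitLaw_inBlobHull_of_le {x : ℝ} (hx : x ≤ (17 : ℝ) / 50) : InBlobHull x (417 / 50) 9 limitLaw := by
  refine ⟨Bool, inferInstance, fun b => if b then 5 / 11 else 6 / 11,
    fun b => if b then [(6, 1), (3, 39 / 50)] else [(8, 1), (1, 17 / 50)], fun b => ?_, ?_, fun b => ?_, fun b => ?_, fun b => ?_, fun h => ?_⟩
  · cases b <;> norm_num
  · simp
    norm_num
  · cases b <;> (intro p hp; simp at hp; rcases hp with rfl | rfl <;> constructor <;> linarith)
  · cases b <;> simp [blobTop]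
  · cases b <;> norm_num [blobMean]
  · simp only [Fintype.sum_bool, if_true, Bool.false_eq_true, if_false]
    rcases Nat.lt_or_ge h 10 with hlt | hge
    · simp only [limitLaw, blobLaw, slice]
      interval_cases h <;> norm_num
    · rw [blobLaw_eq_zero _ h (by simp only [blobTop]; omega), blobLaw_eq_zero _ h (by simp only [blobTop]; omega)]
      simp only [limitLaw]
      rw [if_neg (by omega), if_neg (by omega), if_neg (by omega)]; ring

end LawDec
end Quant
end Summit.CriticalPhenomena.PercolationContinuityZ3.Theorems
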